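import Literature.NumberTheory.Transcendental.CalegariDimitrovTangL2Chi3Proofs
import Mathlib.RingTheory.PowerSeries.Derivative
import Mathlib.RingTheory.PowerSeries.Inverse
import Mathlib.Tactic
import HarnessLib

/-!
# The inhomogeneous Picard–Fuchs equation of `H = aH_A + bH_B + cH_C` (CDT Proposition 122)

Calegari–Dimitrov–Tang, arXiv:2408.15403, §11.1 Proposition 122 (p. 101): under a relation
`a + b·L(2,χ₋₃)/2 + c·ζ(2)/4 = 0`, the `G`-function `H(x) := aH_A(x) + bH_B(x) + cH_C(x)` satisfies
the ODE (eq. (PicardFuchs))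
`x(1−x)(1−9x) y'' + (1 − 20x + 27x²) y' + 3(−1 + 3x) y = b + c/(1−x)`,
"either from equation (zagr) and (zagrt) or more directly using the definitions in terms of
Eichler integrals". This file derives it, as an identity in `ℚ⟦x⟧`, from the coefficient
recurrences proved in `CalegariDimitrovTangL2Chi3Proofs` (`functionsH_rec`,
`functionsH_row_zero`): the `xⁿ`-coefficient of the left side is
`(n+1)² h_{n+1} − (10n² + 10n + 3) h_n + 9n² h_{n−1}`.

* `CalegariDimitrovTang.seriesHA/HB/HC` — `H_A = Σ a_n xⁿ`, `H_B = Σ b_n xⁿ`, `H_C = Σ c_n xⁿ`.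
* `CalegariDimitrovTang.zagierL` — the operator
  `L y = x(1−x)(1−9x) y'' + (1 − 20x + 27x²) y' + 3(3x − 1) y`; `coeff_zagierL`.
* `CalegariDimitrovTang.zagierL_functionsH` — **`L(aH_A + bH_B + cH_C) = b + c/(1−x)`**;
  in particular `L H_A = 0` (eq. (zagr)), `L H_B = 1`, `L H_C = 1/(1−x)`.

No named facts.

## References

* [CalegariDimitrovTang2024] arXiv:2408.15403, §11.1 Lemma 121 eqs. (zagr), (zagrABC),
  Proposition 122 eq. (PicardFuchs) (p. 101).
-/

noncomputable section

open PowerSeries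

namespace Literature.NumberTheory.Transcendental

namespace CalegariDimitrovTang

/-- `H_A(x) = Σ a_n xⁿ ∈ ℤ⟦x⟧ ⊂ ℚ⟦x⟧`, `a_n = Σ_k C(n,k)² C(2k,k)`.
[cite: CalegariDimitrovTang2024, §11.1 Lemma 121 (p. 101)] -/
def seriesHA : ℚ⟦X⟧ := mk fun n => (zagierC n : ℚ)

/-- `H_B(x) = Σ b_n xⁿ`. [cite: CalegariDimitrovTang2024, §11.1 Lemma 121 (p. 101)] -/
def seriesHB : ℚ⟦X⟧ := mk hB

/-- `H_C(x) = Σ c_n xⁿ`. [cite: CalegariDimitrovTang2024, §11.1 Lemma 121 (p. 101)] -/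
def seriesHC : ℚ⟦X⟧ := mk hC

/-- Zagier's differential operator for `Γ₀(6)`, case **C** `(A,B,λ) = (10, 9, 3)`:
`L y = x(1−x)(1−9x) y'' + (1 − 20x + 27x²) y' + 3(3x − 1) y`.
[cite: CalegariDimitrovTang2024, §11.1 Proposition 122 eq. (PicardFuchs) (p. 101)] -/
def zagierL (y : ℚ⟦X⟧) : ℚ⟦X⟧ :=
  (X - C (10 : ℚ) * X ^ 2 + C (9 : ℚ) * X ^ 3) * derivative ℚ (derivative ℚ y) +
    (1 - C (20 : ℚ) * X + C (27 : ℚ) * X ^ 2) * derivative ℚ y + (C (9 : ℚ) * X - C (3 : ℚ)) * y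

/-- Expansion of `L y` into monomial terms. [folklore] -/
theorem zagierL_expand (y : ℚ⟦X⟧) :
    zagierL y = X ^ 1 * derivative ℚ (derivative ℚ y)
      - C (10 : ℚ) * (X ^ 2 * derivative ℚ (derivative ℚ y))
      + C (9 : ℚ) * (X ^ 3 * derivative ℚ (derivative ℚ y))
      + derivative ℚ y - C (20 : ℚ) * (X ^ 1 * derivative ℚ y)
      + C (27 : ℚ) * (X ^ 2 * derivative ℚ y)
      + C (9 : ℚ) * (X ^ 1 * y) - C (3 : ℚ) * y := by
  unfold zagierL
  ring

/-- The `xⁿ`-coefficient of `L y`: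
`(n+1)² y_{n+1} − (10n² + 10n + 3) y_n + 9n² y_{n−1}` (`y_{−1} := 0`).
[cite: CalegariDimitrovTang2024, §11.1 eq. (zagr) (p. 101)] -/
theorem coeff_zagierL (y : ℚ⟦X⟧) (n : ℕ) :
    coeff n (zagierL y) = ((n : ℚ) + 1) ^ 2 * coeff (n + 1) y
      - (10 * (n : ℚ) ^ 2 + 10 * n + 3) * coeff n y
      + 9 * (n : ℚ) ^ 2 * (if n = 0 then 0 else coeff (n - 1) y) := by
  rw [zagierL_expand]
  simp only [map_add, map_sub, coeff_C_mul, coeff_X_pow_mul', coeff_derivative]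
  rcases n with _ | _ | _ | k
  · simp
  · norm_num
    ring
  · norm_num
    ring
  · have h1 : 1 ≤ k + 3 := by omega
    have h2 : 2 ≤ k + 3 := by omega
    have h3 : 3 ≤ k + 3 := by omega
    simp only [h1, h2, h3, if_true, show k + 3 - 1 = k + 2 from rfl,
      show k + 3 - 2 = k + 1 from rfl, show k + 3 - 3 = k from rfl,
      show (k + 3 = 0) = False by simp, if_false]
    push_cast
    ring

/-- `(1 − x)⁻¹ = Σ xⁿ` in `ℚ⟦x⟧`. [folklore] -/
theorem inv_one_sub_X : (1 - X : ℚ⟦X⟧)⁻¹ = mk 1 := by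
  symm
  rw [PowerSeries.eq_inv_iff_mul_eq_one (by simp)]
  ext n
  rcases n with _ | n
  · simp
  · rw [mul_sub, mul_one, map_sub, coeff_one, if_neg (Nat.succ_ne_zero n), mul_comm,
      coeff_succ_X_mul, coeff_mk, coeff_mk, Pi.one_apply, Pi.one_apply, sub_self]

/-- **The Picard–Fuchs equation of Proposition 122**:
`L(aH_A + bH_B + cH_C) = b + c·(1−x)⁻¹` in `ℚ⟦x⟧`, from the coefficient recurrences
(zagr)/(zagrABC): `(n+1)² h_{n+1} − (10n² + 10n + 3) h_n + 9n² h_{n−1} = c + b·[n = 0]`.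
[cite: CalegariDimitrovTang2024, §11.1 Proposition 122 eq. (PicardFuchs) (p. 101)] -/
theorem zagierL_functionsH (a b c : ℚ) :
    zagierL (C a * seriesHA + C b * seriesHB + C c * seriesHC) = C b + C c * (1 - X)⁻¹ := by
  rw [inv_one_sub_X]
  ext n
  rw [coeff_zagierL]
  simp only [seriesHA, seriesHB, seriesHC, map_add, coeff_C_mul, coeff_mk, coeff_C,
    Pi.one_apply, mul_one]
  rcases n with _ | n
  · simp only [Nat.cast_zero, zero_add, if_true, mul_zero, add_zero]
    have h := functionsH_row_zero a b c
    linear_combination h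
  · simp only [Nat.add_sub_cancel, if_neg (Nat.succ_ne_zero n)]
    have h := functionsH_rec a b c n
    push_cast
    linear_combination h

end CalegariDimitrovTang

end Literature.NumberTheory.Transcendental
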